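import Summits.CriticalPhenomena.PercolationContinuityZ3.Theorems.PercNearOneGluingNoHeavyQuantSGCLightCells
import Summits.CriticalPhenomena.PercolationContinuityZ3.Theorems.PercNearOneGluingNoHeavyQuantSGCLightCellsHD
import HarnessLib

/-!
# QUANT lane R8, T-DEC, leg (III), general second factor of `SingleGateConvClosed`: EVERY one-, two- or three-atom second factor is covered by
# CW + the two light cells — the exhaustive small-support dispatch (companion of `…QuantSGCLightCells`, `…QuantSGCLightCellsHD`)

builds on p205010 (kernel theorem, internal audit signed; external expert review pending)

Support file (`--supports stmt-CriticalPhenomena-4575`), QUANT lane, TYPER seat prim-quant-stmt (gen 30), rung R8 of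
`run/shared/lean/prim/quant/LADDER.md`.  Theorems only, standard axioms, no sorries, no definitions.

In SGC's binder for the first factor `μ₁` and given `WindowMixDEC` (CW) and the cells `SGCLightPair` (L2), `SGCLightTriple` (L3):
* `LawDec.singleGateConvClosed_single_of_windowMix` — `μ₂ = δ_s` (`s ≤ M₂`, `y ≤ q`): CW (a degenerate heavy pair `{s, s; 1}`).
* `LawDec.singleGateConvClosed_pair_of_cells` — `μ₂ = {lo, hi; γ}` admissible (`lo < hi ≤ M₂`, `0 ≤ γ ≤ 1`, top-affordable, gated DEC at every
  layer): heavy top `y ≤ qγ` → CW; light top → L2.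
* `LawDec.singleGateConvClosed_triple_of_cells` — `μ₂` an admissible three-atom law with positive masses: not heavy-decomposable → L3; else
  `singleGateConvClosed_tripleHD_of_windowMix` (CW).
* `LawDec.singleGateConvClosed_support3_of_cells` — the exhaustive dispatch for a second factor supported in three given points
  `s₁ < s₂ < s₃ ≤ M₂` with nonnegative masses, under exactly SGC's hypotheses on it.
* `LawDec.singleGateConvClosed_of_lightCells_left` — the AD3⁺ reduction with the roles of the factors exchanged (`lconv_comm`): it suffices
  that EITHER factor is AD3⁺-decomposed.
So `WindowMixDEC ∧ SGCLightPair ∧ SGCLightTriple` give the conclusion of `SingleGateConvClosed` for every admissible second factor with at most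
three atoms, and for every pair of factors one of which is AD3⁺-decomposed; NOT covered: pairs in which neither factor is (arm-2 g35's
top-affordability-tight 4-atom vertex, memo HEAVY-MIX-G35 §7).  HONEST STATUS: all named conjectures remain OPEN; RATE class log\* / honest
sentence unchanged.

[this work] (this lane).  Nothing here is cited as a published result.  The gluing rows served [cite: KozmaNitzan2024, Conjecture 3 (p. 15)];
product measure [cite: Grimmett1999, §1.3 p. 10].
-/

noncomputable section

namespace Summit.CriticalPhenomena.PercolationContinuityZ3.Theorems

namespace Quant

open Finset

/-- two-point law notation `TP[lo, hi, g, h] = g·[h = hi] + (1 − g)·[h = lo]` (as in the lane's other files). -/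
local notation3 "TP[" lo ", " hi ", " g ", " h "]" =>
  (g : ℝ) * (if (h : ℕ) = (hi : ℕ) then (1 : ℝ) else 0) + (1 - (g : ℝ)) * (if (h : ℕ) = (lo : ℕ) then (1 : ℝ) else 0)

namespace LawDec

/-- **one atom**: `μ₂ = δ_s`, `s ≤ M₂`, `y ≤ q` (which top-affordability `y·M₂ ≤ q·s` gives as soon as `1 ≤ M₂`): the conclusion of
`SingleGateConvClosed` from CW — `δ_s` is the heavy pair `{s, s; 1}`. [this work] -/
theorem singleGateConvClosed_single_of_windowMix (hCW : WindowMixDEC) (y q : ℝ) (M₁ M₂ s : ℕ) (μ₁ : ℕ → ℝ)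
    (hy0 : 0 < y) (hy1 : y < 1) (hq0 : 0 < q) (hq1 : q ≤ 1)
    (hμ0 : ∀ h, 0 ≤ μ₁ h) (hμM : ∀ h, M₁ < h → μ₁ h = 0) (hμ1 : ∑ h ∈ Finset.range (M₁ + 1), μ₁ h = 1)
    (hta : y * (M₁ : ℝ) ≤ q * ∑ h ∈ Finset.range (M₁ + 1), (h : ℝ) * μ₁ h)
    (hD : ∀ j', j' < M₁ → DECAt y j' M₁ (gate μ₁ q)) (hs : s ≤ M₂) (hyq : y ≤ q) :
    ∀ j', j' < M₁ + M₂ → DECAt y j' (M₁ + M₂) (gate (lconv M₁ M₂ μ₁ (fun h => if h = s then (1 : ℝ) else 0)) q) := by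
  have h := singleGateConvClosed_heavyMix_of_windowMix hCW y q (s : ℝ) M₁ M₂ μ₁ (ι := Unit) (fun _ => (1 : ℝ)) (fun _ => (1 : ℝ))
    (fun _ => s) (fun _ => s) hy0 hy1 hq0 hq1 hμ0 hμM hμ1 hta hD (fun _ => zero_le_one) (by simp) (fun _ => le_rfl)
    (fun _ => by rw [mul_one]; exact hyq) (fun _ => le_rfl) (fun _ => hs) (fun _ => by ring)
  have e : (fun h => ∑ _i : Unit, (1 : ℝ) * TP[s, s, (1 : ℝ), h]) = fun h => if h = s then (1 : ℝ) else 0 := by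
    funext h; simp only [Finset.univ_unique, Finset.sum_singleton]; ring
  rw [← e]; exact h

/-- **two atoms**: `μ₂ = {lo, hi; γ}` admissible — `lo < hi ≤ M₂`, `0 ≤ γ ≤ 1`, top-affordable `y·M₂ ≤ q(lo + (hi−lo)γ)`, `gate_q μ₂` DEC at
every layer `j′ < M₂`: the conclusion of `SingleGateConvClosed` from CW (heavy top `y ≤ qγ`) or from the cell `SGCLightPair` (light top). [this work] -/
theorem singleGateConvClosed_pair_of_cells (hCW : WindowMixDEC) (hL2 : SGCLightPair) (y q γ : ℝ) (M₁ M₂ lo hi : ℕ) (μ₁ : ℕ → ℝ)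
    (hy0 : 0 < y) (hy1 : y < 1) (hq0 : 0 < q) (hq1 : q ≤ 1)
    (hμ0 : ∀ h, 0 ≤ μ₁ h) (hμM : ∀ h, M₁ < h → μ₁ h = 0) (hμ1 : ∑ h ∈ Finset.range (M₁ + 1), μ₁ h = 1)
    (hta : y * (M₁ : ℝ) ≤ q * ∑ h ∈ Finset.range (M₁ + 1), (h : ℝ) * μ₁ h)
    (hD : ∀ j', j' < M₁ → DECAt y j' M₁ (gate μ₁ q))
    (hlohi : lo < hi) (hhi : hi ≤ M₂) (hγ0 : 0 ≤ γ) (hγ1 : γ ≤ 1)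
    (hta₂ : y * (M₂ : ℝ) ≤ q * ((lo : ℝ) + ((hi : ℝ) - lo) * γ))
    (hD₂ : ∀ j', j' < M₂ → DECAt y j' M₂ (gate (fun h => TP[lo, hi, γ, h]) q)) :
    ∀ j', j' < M₁ + M₂ → DECAt y j' (M₁ + M₂) (gate (lconv M₁ M₂ μ₁ (fun h => TP[lo, hi, γ, h])) q) := by
  by_cases hheavy : y ≤ q * γ
  · have h := singleGateConvClosed_heavyMix_of_windowMix hCW y q ((lo : ℝ) + ((hi : ℝ) - lo) * γ) M₁ M₂ μ₁ (ι := Unit)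
      (fun _ => (1 : ℝ)) (fun _ => γ) (fun _ => lo) (fun _ => hi) hy0 hy1 hq0 hq1 hμ0 hμM hμ1 hta hD (fun _ => zero_le_one) (by simp)
      (fun _ => hγ1) (fun _ => hheavy) (fun _ => hlohi.le) (fun _ => hhi) (fun _ => rfl)
    have e : (fun h => ∑ _i : Unit, (1 : ℝ) * TP[lo, hi, γ, h]) = fun h => TP[lo, hi, γ, h] := by
      funext h; simp only [Finset.univ_unique, Finset.sum_singleton, one_mul]
    rw [← e]; exact h
  · rw [not_le] at hheavy
    exact hL2 y q γ M₁ M₂ lo hi μ₁ hy0 hy1 hq0 hq1 hμ0 hμM hμ1 hta hD hlohi hhi hγ0 hγ1 hheavy hta₂ hD₂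

/-- **three atoms**: `μ₂ = p₁δ_{s₁} + p₂δ_{s₂} + p₃δ_{s₃}` admissible with positive masses — `s₁ < s₂ < s₃ ≤ M₂`, `Σ pᵢ = 1`, mean `T₂`,
`y·M₂ ≤ q·T₂`, gated version DEC at every layer `j′ < M₂`: the conclusion of `SingleGateConvClosed` from the cell `SGCLightTriple` (not
heavy-decomposable) or from CW (`singleGateConvClosed_tripleHD_of_windowMix`). [this work] -/
theorem singleGateConvClosed_triple_of_cells (hCW : WindowMixDEC) (hL3 : SGCLightTriple) (y q p₁ p₂ p₃ T₂ : ℝ) (M₁ M₂ s₁ s₂ s₃ : ℕ)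
    (μ₁ : ℕ → ℝ) (hy0 : 0 < y) (hy1 : y < 1) (hq0 : 0 < q) (hq1 : q ≤ 1)
    (hμ0 : ∀ h, 0 ≤ μ₁ h) (hμM : ∀ h, M₁ < h → μ₁ h = 0) (hμ1 : ∑ h ∈ Finset.range (M₁ + 1), μ₁ h = 1)
    (hta : y * (M₁ : ℝ) ≤ q * ∑ h ∈ Finset.range (M₁ + 1), (h : ℝ) * μ₁ h)
    (hD : ∀ j', j' < M₁ → DECAt y j' M₁ (gate μ₁ q))
    (h12 : s₁ < s₂) (h23 : s₂ < s₃) (h3 : s₃ ≤ M₂) (hp₁ : 0 < p₁) (hp₂ : 0 < p₂) (hp₃ : 0 < p₃) (hp : p₁ + p₂ + p₃ = 1)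
    (hT : p₁ * (s₁ : ℝ) + p₂ * (s₂ : ℝ) + p₃ * (s₃ : ℝ) = T₂) (hta₂ : y * (M₂ : ℝ) ≤ q * T₂)
    (hD₂ : ∀ j', j' < M₂ → DECAt y j' M₂
      (gate (fun h => p₁ * (if h = s₁ then (1 : ℝ) else 0) + p₂ * (if h = s₂ then (1 : ℝ) else 0)
        + p₃ * (if h = s₃ then (1 : ℝ) else 0)) q)) :
    ∀ j', j' < M₁ + M₂ → DECAt y j' (M₁ + M₂)
      (gate (lconv M₁ M₂ μ₁ (fun h => p₁ * (if h = s₁ then (1 : ℝ) else 0) + p₂ * (if h = s₂ then (1 : ℝ) else 0)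
        + p₃ * (if h = s₃ then (1 : ℝ) else 0))) q) := by
  by_cases hcell : ((s₂ : ℝ) ≤ T₂ ∧ q * (T₂ - s₂) < y * ((s₃ : ℝ) - s₂) ∨ T₂ < (s₂ : ℝ) ∧ q * (T₂ - s₁) < y * ((s₃ : ℝ) - s₁))
  · exact hL3 y q p₁ p₂ p₃ T₂ M₁ M₂ s₁ s₂ s₃ μ₁ hy0 hy1 hq0 hq1 hμ0 hμM hμ1 hta hD h12 h23 h3 hp₁ hp₂ hp₃ hp hT hta₂ hcell hD₂
  · have hHD : ((s₂ : ℝ) ≤ T₂ → y * ((s₃ : ℝ) - s₂) ≤ q * (T₂ - s₂)) ∧ (T₂ < (s₂ : ℝ) → y * ((s₃ : ℝ) - s₁) ≤ q * (T₂ - s₁)) := by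
      constructor
      · intro h; by_contra hc; exact hcell (Or.inl ⟨h, lt_of_not_ge hc⟩)
      · intro h; by_contra hc; exact hcell (Or.inr ⟨h, lt_of_not_ge hc⟩)
    exact singleGateConvClosed_tripleHD_of_windowMix hCW y q p₁ p₂ p₃ T₂ M₁ M₂ s₁ s₂ s₃ μ₁ hy0 hy1 hq0 hq1 hμ0 hμM hμ1 hta hD h12 h23
      h3 hp₁ hp₂ hp₃ hp hT hHD

/-- **SUPPORT IN THREE GIVEN POINTS** (the exhaustive small-support dispatch).  In SGC's binder for `μ₁`, let the second factor be
`μ₂ = p₁δ_{s₁} + p₂δ_{s₂} + p₃δ_{s₃}` with `s₁ < s₂ < s₃ ≤ M₂`, NONNEGATIVE masses (zeros allowed: one, two or three atoms), `Σ pᵢ = 1`,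
top-affordable (`y·M₂ ≤ q·Σ pᵢsᵢ`) and with its gated version DEC at every layer `j′ < M₂` — i.e. exactly SGC's hypotheses on a second factor
supported in `{s₁, s₂, s₃}`.  Then `WindowMixDEC`, `SGCLightPair`, `SGCLightTriple` give SGC's conclusion: by the zero pattern of the masses,
`singleGateConvClosed_single_of_windowMix` (`y ≤ q` follows from top-affordability since `M₂ ≥ 2`), `singleGateConvClosed_pair_of_cells`, or
`singleGateConvClosed_triple_of_cells`. [this work] -/
theorem singleGateConvClosed_support3_of_cells (hCW : WindowMixDEC) (hL2 : SGCLightPair) (hL3 : SGCLightTriple) (y q p₁ p₂ p₃ : ℝ)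
    (M₁ M₂ s₁ s₂ s₃ : ℕ) (μ₁ : ℕ → ℝ) (hy0 : 0 < y) (hy1 : y < 1) (hq0 : 0 < q) (hq1 : q ≤ 1)
    (hμ0 : ∀ h, 0 ≤ μ₁ h) (hμM : ∀ h, M₁ < h → μ₁ h = 0) (hμ1 : ∑ h ∈ Finset.range (M₁ + 1), μ₁ h = 1)
    (hta : y * (M₁ : ℝ) ≤ q * ∑ h ∈ Finset.range (M₁ + 1), (h : ℝ) * μ₁ h)
    (hD : ∀ j', j' < M₁ → DECAt y j' M₁ (gate μ₁ q))
    (h12 : s₁ < s₂) (h23 : s₂ < s₃) (h3 : s₃ ≤ M₂) (hp₁ : 0 ≤ p₁) (hp₂ : 0 ≤ p₂) (hp₃ : 0 ≤ p₃) (hp : p₁ + p₂ + p₃ = 1)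
    (hta₂ : y * (M₂ : ℝ) ≤ q * (p₁ * (s₁ : ℝ) + p₂ * (s₂ : ℝ) + p₃ * (s₃ : ℝ)))
    (hD₂ : ∀ j', j' < M₂ → DECAt y j' M₂
      (gate (fun h => p₁ * (if h = s₁ then (1 : ℝ) else 0) + p₂ * (if h = s₂ then (1 : ℝ) else 0)
        + p₃ * (if h = s₃ then (1 : ℝ) else 0)) q)) :
    ∀ j', j' < M₁ + M₂ → DECAt y j' (M₁ + M₂)
      (gate (lconv M₁ M₂ μ₁ (fun h => p₁ * (if h = s₁ then (1 : ℝ) else 0) + p₂ * (if h = s₂ then (1 : ℝ) else 0)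
        + p₃ * (if h = s₃ then (1 : ℝ) else 0))) q) := by
  have hs12 : (s₁ : ℝ) < s₂ := by exact_mod_cast h12
  have hs23 : (s₂ : ℝ) < s₃ := by exact_mod_cast h23
  have hs3 : (s₃ : ℝ) ≤ M₂ := by exact_mod_cast h3
  have hM₂ : (0 : ℝ) < M₂ := by
    have : (0 : ℝ) ≤ (s₂ : ℝ) := Nat.cast_nonneg _
    linarith
  -- `y ≤ q` from top-affordability: the mean is at most `s₃ ≤ M₂`
  have hyq : y ≤ q := by
    have hmean : p₁ * (s₁ : ℝ) + p₂ * (s₂ : ℝ) + p₃ * (s₃ : ℝ) ≤ (M₂ : ℝ) := by nlinarith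
    have h1 : y * (M₂ : ℝ) ≤ q * (M₂ : ℝ) := hta₂.trans (mul_le_mul_of_nonneg_left hmean hq0.le)
    exact le_of_mul_le_mul_right h1 hM₂
  by_cases e₁ : p₁ = 0
  · by_cases e₂ : p₂ = 0
    · -- `δ_{s₃}`
      have e₃ : p₃ = 1 := by linarith
      have e : (fun h : ℕ => p₁ * (if h = s₁ then (1 : ℝ) else 0) + p₂ * (if h = s₂ then (1 : ℝ) else 0)
          + p₃ * (if h = s₃ then (1 : ℝ) else 0)) = fun h => if h = s₃ then (1 : ℝ) else 0 := by
        funext h; rw [e₁, e₂, e₃]; ring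
      rw [e]
      exact singleGateConvClosed_single_of_windowMix hCW y q M₁ M₂ s₃ μ₁ hy0 hy1 hq0 hq1 hμ0 hμM hμ1 hta hD h3 hyq
    · by_cases e₃ : p₃ = 0
      · -- `δ_{s₂}`
        have e₂' : p₂ = 1 := by linarith
        have e : (fun h : ℕ => p₁ * (if h = s₁ then (1 : ℝ) else 0) + p₂ * (if h = s₂ then (1 : ℝ) else 0)
            + p₃ * (if h = s₃ then (1 : ℝ) else 0)) = fun h => if h = s₂ then (1 : ℝ) else 0 := by
          funext h; rw [e₁, e₂', e₃]; ring
        rw [e]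
        exact singleGateConvClosed_single_of_windowMix hCW y q M₁ M₂ s₂ μ₁ hy0 hy1 hq0 hq1 hμ0 hμM hμ1 hta hD (by omega) hyq
      · -- pair `{s₂, s₃; p₃}`
        have e₂' : p₂ = 1 - p₃ := by linarith
        have e : (fun h : ℕ => p₁ * (if h = s₁ then (1 : ℝ) else 0) + p₂ * (if h = s₂ then (1 : ℝ) else 0)
            + p₃ * (if h = s₃ then (1 : ℝ) else 0)) = fun h => TP[s₂, s₃, p₃, h] := by
          funext h; rw [e₁, e₂']; ring
        rw [e] at hD₂ ⊢
        refine singleGateConvClosed_pair_of_cells hCW hL2 y q p₃ M₁ M₂ s₂ s₃ μ₁ hy0 hy1 hq0 hq1 hμ0 hμM hμ1 hta hD h23 h3 hp₃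
          (by linarith) ?_ hD₂
        have : p₁ * (s₁ : ℝ) + p₂ * (s₂ : ℝ) + p₃ * (s₃ : ℝ) = (s₂ : ℝ) + ((s₃ : ℝ) - s₂) * p₃ := by rw [e₁, e₂']; ring
        rw [← this]; exact hta₂
  · by_cases e₂ : p₂ = 0
    · by_cases e₃ : p₃ = 0
      · -- `δ_{s₁}`
        have e₁' : p₁ = 1 := by linarith
        have e : (fun h : ℕ => p₁ * (if h = s₁ then (1 : ℝ) else 0) + p₂ * (if h = s₂ then (1 : ℝ) else 0)
            + p₃ * (if h = s₃ then (1 : ℝ) else 0)) = fun h => if h = s₁ then (1 : ℝ) else 0 := by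
          funext h; rw [e₁', e₂, e₃]; ring
        rw [e]
        exact singleGateConvClosed_single_of_windowMix hCW y q M₁ M₂ s₁ μ₁ hy0 hy1 hq0 hq1 hμ0 hμM hμ1 hta hD (by omega) hyq
      · -- pair `{s₁, s₃; p₃}`
        have e₁' : p₁ = 1 - p₃ := by linarith
        have e : (fun h : ℕ => p₁ * (if h = s₁ then (1 : ℝ) else 0) + p₂ * (if h = s₂ then (1 : ℝ) else 0)
            + p₃ * (if h = s₃ then (1 : ℝ) else 0)) = fun h => TP[s₁, s₃, p₃, h] := by
          funext h; rw [e₁', e₂]; ring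
        rw [e] at hD₂ ⊢
        refine singleGateConvClosed_pair_of_cells hCW hL2 y q p₃ M₁ M₂ s₁ s₃ μ₁ hy0 hy1 hq0 hq1 hμ0 hμM hμ1 hta hD (h12.trans h23) h3
          hp₃ (by linarith) ?_ hD₂
        have : p₁ * (s₁ : ℝ) + p₂ * (s₂ : ℝ) + p₃ * (s₃ : ℝ) = (s₁ : ℝ) + ((s₃ : ℝ) - s₁) * p₃ := by rw [e₁', e₂]; ring
        rw [← this]; exact hta₂
    · by_cases e₃ : p₃ = 0
      · -- pair `{s₁, s₂; p₂}`
        have e₁' : p₁ = 1 - p₂ := by linarith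
        have e : (fun h : ℕ => p₁ * (if h = s₁ then (1 : ℝ) else 0) + p₂ * (if h = s₂ then (1 : ℝ) else 0)
            + p₃ * (if h = s₃ then (1 : ℝ) else 0)) = fun h => TP[s₁, s₂, p₂, h] := by
          funext h; rw [e₁', e₃]; ring
        rw [e] at hD₂ ⊢
        refine singleGateConvClosed_pair_of_cells hCW hL2 y q p₂ M₁ M₂ s₁ s₂ μ₁ hy0 hy1 hq0 hq1 hμ0 hμM hμ1 hta hD h12 (by omega)
          hp₂ (by linarith) ?_ hD₂
        have : p₁ * (s₁ : ℝ) + p₂ * (s₂ : ℝ) + p₃ * (s₃ : ℝ) = (s₁ : ℝ) + ((s₂ : ℝ) - s₁) * p₂ := by rw [e₁', e₃]; ring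
        rw [← this]; exact hta₂
      · -- genuine triple
        exact singleGateConvClosed_triple_of_cells hCW hL3 y q p₁ p₂ p₃ _ M₁ M₂ s₁ s₂ s₃ μ₁ hy0 hy1 hq0 hq1 hμ0 hμM hμ1 hta hD h12 h23
          h3 (lt_of_le_of_ne hp₁ (Ne.symm e₁)) (lt_of_le_of_ne hp₂ (Ne.symm e₂)) (lt_of_le_of_ne hp₃ (Ne.symm e₃)) hp rfl hta₂ hD₂

/-- **EITHER FACTOR SUFFICES** (symmetry `lconv_comm`): the conclusion of `SingleGateConvClosed` for `(μ₁, μ₂)` also follows when it is the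
FIRST factor that carries the AD3⁺ decomposition (heavy pairs / admissible light pairs / admissible non-heavy-decomposable triples of its mean
`T₁`, `y·M₁ ≤ q·T₁`) and the SECOND factor is admissible — `singleGateConvClosed_of_lightCells` with the roles exchanged.  So the pairs
`(μ₁, μ₂)` NOT covered by CW + the two light cells are those in which NEITHER factor is AD3⁺-decomposable. [this work] -/
theorem singleGateConvClosed_of_lightCells_left (hCW : WindowMixDEC) (hL2 : SGCLightPair) (hL3 : SGCLightTriple)
    (y q T₁ : ℝ) (M₁ M₂ : ℕ) (μ₁ μ₂ : ℕ → ℝ) {κ : Type} [Fintype κ] (v : κ → ℝ) (ω : κ → ℕ → ℝ)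
    (hy0 : 0 < y) (hy1 : y < 1) (hq0 : 0 < q) (hq1 : q ≤ 1)
    (hν0 : ∀ h, 0 ≤ μ₂ h) (hνM : ∀ h, M₂ < h → μ₂ h = 0) (hν1 : ∑ h ∈ Finset.range (M₂ + 1), μ₂ h = 1)
    (hta₂ : y * (M₂ : ℝ) ≤ q * ∑ h ∈ Finset.range (M₂ + 1), (h : ℝ) * μ₂ h)
    (hD₂ : ∀ j', j' < M₂ → DECAt y j' M₂ (gate μ₂ q))
    (hta₁ : y * (M₁ : ℝ) ≤ q * T₁)
    (hv0 : ∀ k, 0 ≤ v k) (hv1 : ∑ k, v k = 1) (hμ₁ : ∀ h, μ₁ h = ∑ k, v k * ω k h)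
    (hcomp : ∀ k, 0 < v k →
      (∃ (lo hi : ℕ) (γ : ℝ), lo ≤ hi ∧ hi ≤ M₁ ∧ 0 ≤ γ ∧ γ ≤ 1 ∧ y ≤ q * γ ∧
          (lo : ℝ) + ((hi : ℝ) - lo) * γ = T₁ ∧ ω k = fun h => TP[lo, hi, γ, h]) ∨
      (∃ (lo hi : ℕ) (γ : ℝ), lo < hi ∧ hi ≤ M₁ ∧ 0 ≤ γ ∧ γ ≤ 1 ∧ q * γ < y ∧
          (lo : ℝ) + ((hi : ℝ) - lo) * γ = T₁ ∧ (∀ j', j' < M₁ → DECAt y j' M₁ (gate (fun h => TP[lo, hi, γ, h]) q)) ∧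
          ω k = fun h => TP[lo, hi, γ, h]) ∨
      (∃ (s₁ s₂ s₃ : ℕ) (p₁ p₂ p₃ : ℝ), s₁ < s₂ ∧ s₂ < s₃ ∧ s₃ ≤ M₁ ∧ 0 < p₁ ∧ 0 < p₂ ∧ 0 < p₃ ∧ p₁ + p₂ + p₃ = 1 ∧
          p₁ * (s₁ : ℝ) + p₂ * (s₂ : ℝ) + p₃ * (s₃ : ℝ) = T₁ ∧
          ((s₂ : ℝ) ≤ T₁ ∧ q * (T₁ - s₂) < y * ((s₃ : ℝ) - s₂) ∨ T₁ < (s₂ : ℝ) ∧ q * (T₁ - s₁) < y * ((s₃ : ℝ) - s₁)) ∧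
          (∀ j', j' < M₁ → DECAt y j' M₁
            (gate (fun h => p₁ * (if h = s₁ then (1 : ℝ) else 0) + p₂ * (if h = s₂ then (1 : ℝ) else 0)
              + p₃ * (if h = s₃ then (1 : ℝ) else 0)) q)) ∧
          ω k = fun h => p₁ * (if h = s₁ then (1 : ℝ) else 0) + p₂ * (if h = s₂ then (1 : ℝ) else 0)
            + p₃ * (if h = s₃ then (1 : ℝ) else 0))) :
    ∀ j', j' < M₁ + M₂ → DECAt y j' (M₁ + M₂) (gate (lconv M₁ M₂ μ₁ μ₂) q) := by
  intro j' hj'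
  have h := singleGateConvClosed_of_lightCells hCW hL2 hL3 y q T₁ M₂ M₁ μ₂ μ₁ v ω hy0 hy1 hq0 hq1 hν0 hνM hν1 hta₂ hD₂ hta₁ hv0 hv1
    hμ₁ hcomp j' (by omega)
  rw [lconv_comm, Nat.add_comm]; exact h

end LawDec

end Quant

end Summit.CriticalPhenomena.PercolationContinuityZ3.Theorems
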